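import Literature.MeasureTheory.Group.CoveringWeightsCuspidalVanishing
import Literature.NumberTheory.Automorphic.GLnBlockUnipotentAveraging
import Literature.LinearAlgebra.Matrix.SingularMatrixOrbits
import Literature.NumberTheory.Automorphic.GodementJacquetZetaKernelTheta
import Literature.NumberTheory.Automorphic.AutomorphicTwist
import Literature.NumberTheory.Automorphic.UnipotentTateDomain
import HarnessLib

/-!
# Vanishing of the singular theta terms of the Godement–Jacquet reflection formula against cusp forms

Topic `NumberTheory/Automorphic`; namespace `Literature.NumberTheory.Automorphic`. This is the heart
of Godement–Jacquet (1972), §12 for `n ≥ 2`: in the Poisson-summation identity for the truncated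
zeta integral, the theta terms `Σ_{ξ singular, ξ ≠ 0} Φ(x₀ ξ ỹ)` (and their reflected analogues)
integrate to zero against a cusp form in `ỹ`, because after grouping the `ξ` of rank `r`
(`0 < r < n`) into `GL_n(K)`-orbits and unfolding, an inner integral over
`N(K)\N(𝔸_K)` of the cusp form appears, `N` the unipotent radical of a proper maximal parabolic.
The file is written in the tree's formalism: covering weights on the group
(`Literature.MeasureTheory.Group.CoveringWeights*`), the orbit combinatorics of
`Literature.LinearAlgebra.Matrix.SingularMatrixOrbits`, and the block unipotent averaging of
`GLnBlockUnipotentAveraging`.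

* Embedding: `toAdelic_gl_injective`, `countable_arithmeticSubgroup`; the rational stabilisers
  `stabLastAdelic n K r = S'_r(K)`, `stabFirstAdelic n K r = S_r(K)` inside `GL_n(𝔸_K)`, contained in
  the arithmetic subgroup, discrete, inside the standard parabolics `P_{n-r}`, `P_r`
  (`map_mem_standardParabolicGL_of_mem_stabLast/First`, `stabLastParabolic`, `stabFirstParabolic`),
  and with `Γ' ∩ N(𝔸_K) = N(K)` (`mem_stabLastAdelic_iff_logBlockUnipotentGL_mem`,
  `mem_stabFirstAdelic_iff_logBlockUnipotentGL_mem`).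
* Orbit functions: `orbitFunR x₀ s Φ ω ỹ = F₁^<(x₀ ỹ) Φ(x₀ b_ω ỹ)` (right orbits, base point
  `b_ω = P E'_r`) and `orbitFunL x₀ s Ψ ω ỹ = F''_{n-s}(ỹ⁻¹ x₀⁻¹) Ψ(ỹ⁻¹ b_ω x₀⁻¹)` (left orbits,
  `b_ω = E_r Q`) (**definitions**), Borel, invariant under the rational stabiliser and under the
  unipotent radical (`orbitFunR_arith_mul`, `orbitFunR_unipotent_mul`, …).
* `existsUnique_mul_out_mem` — the representatives `s_q = (q.out)⁻¹` of `Stab\GL_n(K)`.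
* **Per-orbit vanishing** `integral_wt_mul_tsum_orbitFunR_eq_zero`, `integral_wt_mul_tsum_orbitFunL_eq_zero`:
  `∫ w(ỹ) ψ(ỹ) Σ_q f_ω(s_q ỹ) dν(ỹ) = 0` for a `GL_n(K)`-covering weight `w`, a continuous
  left-`GL_n(K)`-invariant `ψ` satisfying the cusp conditions along all maximal parabolics
  (`CuspConditionGL`), under absolute convergence — an instance of
  `integral_wt_mul_mul_tsum_eq_zero_of_period_eq_zero`.
* Summation: `tsum_eq_tsum_orbits_of_summable_norm`, `tsum_eq_tsum_orbits_ennreal`,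
  `SingR.tsum_orbit_eq`, `SingL.tsum_orbit_eq`; `integral_wt_mul_tsum_tsum_eq_zero` (`integral_tsum`
  over the orbits); the singular terms `singTermR`, `singTermL` (**definitions**),
  `singTermR_smul_base`, `summable_norm_singTermR`, ….
* **Main**: `integral_wt_mul_tsum_singTermR_eq_zero`, `integral_wt_mul_tsum_singTermL_eq_zero` —
  `∫ w(ỹ) ψ(ỹ) Σ_{ξ ∈ T} F₁(x₀ ỹ) Φ(x₀ ξ ỹ) dν(ỹ) = 0` (`T` the non-zero singular rational
  matrices) and its reflected analogue, given `∫ w |ψ| Σ_ξ |…| dν < ∞`.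

## References

* R. Godement, H. Jacquet, *Zeta functions of simple algebras*, LNM 260 (1972), §12
  [GodementJacquetLNM260].
* H. Jacquet, J. A. Shalika, *On Euler products and the classification of automorphic
  representations I*, Amer. J. Math. 103 (1981), §4 [JacquetShalikaAJM1981].
-/

noncomputable section

open MeasureTheory Measure Set Filter Topology IsDedekindDomain NumberField MulAction
open Literature.MeasureTheory.Group Literature.LinearAlgebra.Matrix
open scoped ENNReal NNReal

namespace Literature.NumberTheory.Automorphic

variable {n : ℕ} {K : Type} [Field K] [NumberField K]

attribute [local instance] adelicBorel borelSpace_adelic locallyCompactSpace_adelic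
  secondCountableTopology_gl_adelic glBorel borelSpace_glBorel

/-! ### The rational stabilisers inside `GL_n(𝔸_K)` -/

section Embedding

/-- The arithmetic subgroup `GL_n(K) ≤ GL_n(𝔸_K)` is countable. [folklore] -/
instance countable_arithmeticSubgroup : Countable (AdelicGroupData.gl n K).arithmeticSubgroup := by
  haveI : Countable (AdelicGroupData.gl n K).Rational := countable_generalLinearGroup_numberField n K
  exact (MonoidHom.rangeRestrict_surjective (AdelicGroupData.gl n K).toAdelic).countable

variable (n K) in
/-- **The right stabiliser `S'_r(K) = {γ : E'_r γ = E'_r}` inside `GL_n(𝔸_K)`.** [folklore] -/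
def stabLastAdelic (r : ℕ) : Subgroup (AdelicGroupData.gl n K).Adelic :=
  (stabLast n K r).map (AdelicGroupData.gl n K).toAdelic

variable (n K) in
/-- **The left stabiliser `S_r(K) = {γ : γ E_r = E_r}` inside `GL_n(𝔸_K)`.** [folklore] -/
def stabFirstAdelic (r : ℕ) : Subgroup (AdelicGroupData.gl n K).Adelic :=
  (stabFirst n K r).map (AdelicGroupData.gl n K).toAdelic

/-- `S'_r(K) ≤ GL_n(K)`. [folklore] -/
theorem stabLastAdelic_le (r : ℕ) : stabLastAdelic n K r ≤ (AdelicGroupData.gl n K).arithmeticSubgroup :=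
  Subgroup.map_le_range _ _

/-- `S_r(K) ≤ GL_n(K)`. [folklore] -/
theorem stabFirstAdelic_le (r : ℕ) : stabFirstAdelic n K r ≤ (AdelicGroupData.gl n K).arithmeticSubgroup :=
  Subgroup.map_le_range _ _

/-- Membership of `γ ∈ GL_n(K)` in `S'_r(K) ≤ GL_n(𝔸_K)`. [folklore] -/
theorem toAdelic_mem_stabLastAdelic_iff {r : ℕ} {γ : GL (Fin n) K} :
    (AdelicGroupData.gl n K).toAdelic γ ∈ stabLastAdelic n K r ↔ γ ∈ stabLast n K r := by
  constructor
  · rintro ⟨δ, hδ, h⟩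
    rwa [← toAdelic_gl_injective h]
  · exact fun h => ⟨γ, h, rfl⟩

/-- Membership of `γ ∈ GL_n(K)` in `S_r(K) ≤ GL_n(𝔸_K)`. [folklore] -/
theorem toAdelic_mem_stabFirstAdelic_iff {r : ℕ} {γ : GL (Fin n) K} :
    (AdelicGroupData.gl n K).toAdelic γ ∈ stabFirstAdelic n K r ↔ γ ∈ stabFirst n K r := by
  constructor
  · rintro ⟨δ, hδ, h⟩
    rwa [← toAdelic_gl_injective h]
  · exact fun h => ⟨γ, h, rfl⟩

/-- The rational stabilisers are discrete. [folklore] -/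
theorem discreteTopology_of_le_arithmeticSubgroup {Δ : Subgroup (AdelicGroupData.gl n K).Adelic}
    (h : Δ ≤ (AdelicGroupData.gl n K).arithmeticSubgroup) : DiscreteTopology Δ :=
  DiscreteTopology.of_subset (s := ((AdelicGroupData.gl n K).arithmeticSubgroup : Set (AdelicGroupData.gl n K).Adelic))
    (instDiscreteTopologyArithmeticSubgroup (n := n) (K := K)) h

/-- **`S'_r(K) ⊆ P_{n-r}`**: the rational right stabiliser of `E'_r` consists of block upper
triangular matrices for the label of the maximal parabolic `P_{n-r}`. [folklore] -/
theorem map_mem_standardParabolicGL_of_mem_stabLast {r : ℕ} {γ : GL (Fin n) K} (hγ : γ ∈ stabLast n K r) :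
    Matrix.GeneralLinearGroup.map (algebraMap K (AdeleRing (𝓞 K) K)) γ ∈
      standardParabolicGL (AdeleRing (𝓞 K) K) (maximalParabolicLabel n (n - r)) := by
  intro i j hij
  simp only [maximalParabolicLabel] at hij
  by_cases hj : (j : ℕ) < n - r <;> by_cases hi : (i : ℕ) < n - r <;> simp [hj, hi] at hij
  change algebraMap K (AdeleRing (𝓞 K) K) ((γ : Matrix (Fin n) (Fin n) K) i j) = 0
  rw [apply_eq_zero_of_rankStdMatrixLast_mul_eq (mem_stabLast_iff.1 hγ) (not_lt.1 hi) hj, map_zero]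

/-- **`S_r(K) ⊆ P_r`**: the rational left stabiliser of `E_r` is block upper triangular for the label
of `P_r`. [folklore] -/
theorem map_mem_standardParabolicGL_of_mem_stabFirst {r : ℕ} {γ : GL (Fin n) K} (hγ : γ ∈ stabFirst n K r) :
    Matrix.GeneralLinearGroup.map (algebraMap K (AdeleRing (𝓞 K) K)) γ ∈
      standardParabolicGL (AdeleRing (𝓞 K) K) (maximalParabolicLabel n r) := by
  intro i j hij
  simp only [maximalParabolicLabel] at hij
  by_cases hj : (j : ℕ) < r <;> by_cases hi : (i : ℕ) < r <;> simp [hj, hi] at hij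
  change algebraMap K (AdeleRing (𝓞 K) K) ((γ : Matrix (Fin n) (Fin n) K) i j) = 0
  rw [apply_eq_zero_of_mul_rankStdMatrix_eq (mem_stabFirst_iff.1 hγ) (not_lt.1 hi) hj, map_zero]

/-- A rational right-stabiliser element as an element of `P_{n-r}(𝔸_K)`. [folklore] -/
def stabLastParabolic {r : ℕ} {γ : GL (Fin n) K} (hγ : γ ∈ stabLast n K r) :
    standardParabolicGL (AdeleRing (𝓞 K) K) (maximalParabolicLabel n (n - r)) :=
  ⟨_, map_mem_standardParabolicGL_of_mem_stabLast hγ⟩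

/-- A rational left-stabiliser element as an element of `P_r(𝔸_K)`. [folklore] -/
def stabFirstParabolic {r : ℕ} {γ : GL (Fin n) K} (hγ : γ ∈ stabFirst n K r) :
    standardParabolicGL (AdeleRing (𝓞 K) K) (maximalParabolicLabel n r) :=
  ⟨_, map_mem_standardParabolicGL_of_mem_stabFirst hγ⟩

/-- The underlying adelic matrix of `stabLastParabolic`. [folklore] -/
theorem coe_stabLastParabolic {r : ℕ} {γ : GL (Fin n) K} (hγ : γ ∈ stabLast n K r) :
    ((stabLastParabolic hγ : standardParabolicGL (AdeleRing (𝓞 K) K) (maximalParabolicLabel n (n - r))) :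
      GL (Fin n) (AdeleRing (𝓞 K) K)) = Matrix.GeneralLinearGroup.map (algebraMap K (AdeleRing (𝓞 K) K)) γ := rfl

/-- The underlying adelic matrix of `stabFirstParabolic`. [folklore] -/
theorem coe_stabFirstParabolic {r : ℕ} {γ : GL (Fin n) K} (hγ : γ ∈ stabFirst n K r) :
    ((stabFirstParabolic hγ : standardParabolicGL (AdeleRing (𝓞 K) K) (maximalParabolicLabel n r)) :
      GL (Fin n) (AdeleRing (𝓞 K) K)) = Matrix.GeneralLinearGroup.map (algebraMap K (AdeleRing (𝓞 K) K)) γ := rfl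

/-- `stabLastParabolic hγ`, read in the adelic group, is `γ`. [folklore] -/
theorem parabolicToAdelic_stabLastParabolic {r : ℕ} {γ : GL (Fin n) K} (hγ : γ ∈ stabLast n K r) :
    parabolicToAdelic (stabLastParabolic hγ) = (AdelicGroupData.gl n K).toAdelic γ := rfl

/-- `stabFirstParabolic hγ`, read in the adelic group, is `γ`. [folklore] -/
theorem parabolicToAdelic_stabFirstParabolic {r : ℕ} {γ : GL (Fin n) K} (hγ : γ ∈ stabFirst n K r) :
    parabolicToAdelic (stabFirstParabolic hγ) = (AdelicGroupData.gl n K).toAdelic γ := rfl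

/-! #### `Γ' ∩ N(𝔸_K) = N(K)` for the two stabilisers -/

/-- The entries of `u - 1` for `u = γ ∈ GL_n(K)` are principal adeles. [folklore] -/
theorem logBlockUnipotentGL_mem_rationalBlock_of_eq_toAdelic {k : ℕ} {u : blockUnipotentGL n k K}
    {γ : GL (Fin n) K} (h : (u : (AdelicGroupData.gl n K).Adelic) = (AdelicGroupData.gl n K).toAdelic γ) :
    logBlockUnipotentGL u ∈ rationalBlock n k K := by
  rw [mem_rationalBlock_iff]
  intro i j
  change Units.val ((u : blockUnipotentGL n k K) : (AdelicGroupData.gl n K).Adelic) i j -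
      (1 : Matrix (Fin n) (Fin n) (AdeleRing (𝓞 K) K)) i j ∈ _
  rw [h, coe_toAdelic_gl]
  refine ⟨(γ : Matrix (Fin n) (Fin n) K) i j - (1 : Matrix (Fin n) (Fin n) K) i j, ?_⟩
  simp only [map_sub, ratMatrix, Matrix.map_apply, Matrix.one_apply]
  split_ifs <;> simp

/-- **A block unipotent adelic matrix with principal entries is the image of a rational block
unipotent matrix** `1 + Y`, `Y ∈ 𝔫_k(K)`. [folklore] -/
theorem exists_eq_toAdelic_of_mem_rationalBlock {k : ℕ} {u : blockUnipotentGL n k K}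
    (h : logBlockUnipotentGL u ∈ rationalBlock n k K) :
    ∃ Y : blockNilpotent n k K, (u : (AdelicGroupData.gl n K).Adelic) =
      (AdelicGroupData.gl n K).toAdelic (unipotentOfBlock n k K (Multiplicative.ofAdd Y)) := by
  rw [mem_rationalBlock_iff] at h
  choose Y hY using h
  set X := logBlockUnipotentGL u with hX
  have hYX : ∀ i j, algebraMap K (AdeleRing (𝓞 K) K) (Y i j) = (X : Matrix (Fin n) (Fin n) (AdeleRing (𝓞 K) K)) i j :=
    fun i j => hY i j
  have hYmem : (Matrix.of fun i j => Y i j) ∈ blockNilpotent n k K := by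
    intro i j hij
    rw [Matrix.of_apply] at hij
    refine X.2 i j ?_
    rw [← hYX]
    intro h0
    exact hij (NumberField.AdeleRing.algebraMap_injective (𝓞 K) K (h0.trans (map_zero _).symm))
  refine ⟨⟨Matrix.of fun i j => Y i j, hYmem⟩, Units.ext ?_⟩
  rw [coe_toAdelic_gl, coe_unipotentOfBlock, toAdd_ofAdd]
  have hu : (u : (AdelicGroupData.gl n K).Adelic) = (toBlockUnipotentGL n k K X : (AdelicGroupData.gl n K).Adelic) := by
    rw [hX, toBlockUnipotentGL_logBlockUnipotentGL]
  rw [hu, coe_toBlockUnipotentGL, glUnipotent_apply, coe_unipotentOfBlock, toAdd_ofAdd]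
  ext i j
  simp only [ratMatrix, Matrix.map_apply, Matrix.add_apply, map_add, Matrix.one_apply, Matrix.of_apply]
  congr 1
  · split_ifs <;> simp
  · exact (hYX i j).symm

/-- **`S'_r(K) ∩ N_{n-r}(𝔸_K) = N_{n-r}(K)`** (hypothesis `hΓ'` of
`existsUnique_mul_mem_blockUnipotentDomain`). [folklore] -/
theorem mem_stabLastAdelic_iff_logBlockUnipotentGL_mem {r : ℕ} (u : blockUnipotentGL n (n - r) K) :
    (u : (AdelicGroupData.gl n K).Adelic) ∈ stabLastAdelic n K r ↔
      logBlockUnipotentGL u ∈ rationalBlock n (n - r) K := by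
  constructor
  · rintro ⟨γ, -, hγu⟩
    exact logBlockUnipotentGL_mem_rationalBlock_of_eq_toAdelic hγu.symm
  · intro h
    obtain ⟨Y, hY⟩ := exists_eq_toAdelic_of_mem_rationalBlock h
    rw [hY, toAdelic_mem_stabLastAdelic_iff, mem_stabLast_iff, coe_unipotentOfBlock, toAdd_ofAdd]
    exact rankStdMatrixLast_mul_one_add_eq Y.2

/-- **`S_r(K) ∩ N_r(𝔸_K) = N_r(K)`.** [folklore] -/
theorem mem_stabFirstAdelic_iff_logBlockUnipotentGL_mem {r : ℕ} (u : blockUnipotentGL n r K) :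
    (u : (AdelicGroupData.gl n K).Adelic) ∈ stabFirstAdelic n K r ↔
      logBlockUnipotentGL u ∈ rationalBlock n r K := by
  constructor
  · rintro ⟨γ, -, hγu⟩
    exact logBlockUnipotentGL_mem_rationalBlock_of_eq_toAdelic hγu.symm
  · intro h
    obtain ⟨Y, hY⟩ := exists_eq_toAdelic_of_mem_rationalBlock h
    rw [hY, toAdelic_mem_stabFirstAdelic_iff, mem_stabFirst_iff, coe_unipotentOfBlock, toAdd_ofAdd]
    exact one_add_mul_rankStdMatrix_eq Y.2

end Embedding

/-! ### Helper facts on `|det|` and on the base points -/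

section Helpers

/-- `|det (x (γ y))|_𝔸 = |det (x y)|_𝔸` for `γ` in the arithmetic subgroup. [folklore] -/
theorem adelicAbsDet_mul_arith_mul {γ : GL (Fin n) (AdeleRing (𝓞 K) K)}
    (hγ : γ ∈ (AdelicGroupData.gl n K).arithmeticSubgroup) (x y : GL (Fin n) (AdeleRing (𝓞 K) K)) :
    adelicAbsDet n K (x * (γ * y)) = adelicAbsDet n K (x * y) := by
  simp only [map_mul, adelicAbsDet_eq_one_of_mem_arithmeticSubgroup hγ, one_mul]

/-- `|det ((γ y)⁻¹ x)|_𝔸 = |det (y⁻¹ x)|_𝔸` for `γ` in the arithmetic subgroup. [folklore] -/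
theorem adelicAbsDet_arith_mul_inv_mul {γ : GL (Fin n) (AdeleRing (𝓞 K) K)}
    (hγ : γ ∈ (AdelicGroupData.gl n K).arithmeticSubgroup) (x y : GL (Fin n) (AdeleRing (𝓞 K) K)) :
    adelicAbsDet n K ((γ * y)⁻¹ * x) = adelicAbsDet n K (y⁻¹ * x) := by
  have h1 : adelicAbsDet n K γ⁻¹ = 1 := adelicAbsDet_eq_one_of_mem_arithmeticSubgroup (inv_mem hγ)
  rw [_root_.mul_inv_rev]
  simp only [map_mul, h1, mul_one]

/-- `|det (1 + X)|_𝔸 = 1` on the block unipotent subgroup. [folklore] -/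
theorem adelicAbsDet_eq_one_of_mem_blockUnipotentGL {k : ℕ} {u : (AdelicGroupData.gl n K).Adelic}
    (hu : u ∈ blockUnipotentGL n k K) : adelicAbsDet n K u = 1 := by
  obtain ⟨X, rfl⟩ := hu
  rw [adelicAbsDet_apply, glUnipotent_apply, det_unipotentOfBlock, map_one]

/-- `|det (x (u y))|_𝔸 = |det (x y)|_𝔸` for `u` block unipotent. [folklore] -/
theorem adelicAbsDet_mul_unipotent_mul {k : ℕ} {u : GL (Fin n) (AdeleRing (𝓞 K) K)}
    (hu : u ∈ blockUnipotentGL n k K) (x y : GL (Fin n) (AdeleRing (𝓞 K) K)) :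
    adelicAbsDet n K (x * (u * y)) = adelicAbsDet n K (x * y) := by
  simp only [map_mul, adelicAbsDet_eq_one_of_mem_blockUnipotentGL hu, one_mul]

/-- `|det ((u y)⁻¹ x)|_𝔸 = |det (y⁻¹ x)|_𝔸` for `u` block unipotent. [folklore] -/
theorem adelicAbsDet_unipotent_mul_inv_mul {k : ℕ} {u : GL (Fin n) (AdeleRing (𝓞 K) K)}
    (hu : u ∈ blockUnipotentGL n k K) (x y : GL (Fin n) (AdeleRing (𝓞 K) K)) :
    adelicAbsDet n K ((u * y)⁻¹ * x) = adelicAbsDet n K (y⁻¹ * x) := by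
  have h1 : adelicAbsDet n K u⁻¹ = 1 :=
    adelicAbsDet_eq_one_of_mem_blockUnipotentGL (inv_mem hu)
  rw [_root_.mul_inv_rev]
  simp only [map_mul, h1, mul_one]

/-- `ratMatrix` of the standard idempotents. [folklore] -/
theorem map_rankStdMatrixLast (r : ℕ) :
    (rankStdMatrixLast n r K).map (algebraMap K (AdeleRing (𝓞 K) K)) = rankStdMatrixLast n r (AdeleRing (𝓞 K) K) := by
  unfold rankStdMatrixLast
  rw [Matrix.diagonal_map (map_zero _)]
  congr 1
  funext i
  split_ifs <;> simp

/-- `ratMatrix` of `E_r`. [folklore] -/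
theorem map_rankStdMatrix (r : ℕ) :
    (rankStdMatrix n r K).map (algebraMap K (AdeleRing (𝓞 K) K)) = rankStdMatrix n r (AdeleRing (𝓞 K) K) := by
  unfold rankStdMatrix
  rw [Matrix.diagonal_map (map_zero _)]
  congr 1
  funext i
  split_ifs <;> simp

omit [NumberField K] in
/-- The rank of a non-zero singular matrix lies strictly between `0` and `n`. [folklore] -/
theorem rank_pos_and_lt_of_singR (ξ : SingR n K) : 0 < ξ.1.rank ∧ ξ.1.rank < n := by
  obtain ⟨P, Q, h⟩ := exists_units_eq_mul_rankStdMatrix_mul ξ.1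
  constructor
  · rw [pos_iff_ne_zero]
    intro h0
    apply ξ.2.2
    rw [h, h0]
    have : rankStdMatrix n 0 K = 0 := by
      unfold rankStdMatrix
      ext i j
      simp [Matrix.diagonal_apply]
    rw [this, Matrix.mul_zero, Matrix.zero_mul]
  · refine lt_of_le_of_ne ((Matrix.rank_le_card_width ξ.1).trans_eq (Fintype.card_fin n)) fun hn => ?_
    apply ξ.2.1
    rw [h, hn]
    have : rankStdMatrix n n K = 1 := by
      unfold rankStdMatrix
      ext i j
      simp [Matrix.diagonal_apply, Matrix.one_apply]
    rw [this, Matrix.mul_one]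
    exact (Units.isUnit P).mul (Units.isUnit Q)

omit [NumberField K] in
/-- The same for `SingL` (same underlying set). [folklore] -/
theorem rank_pos_and_lt_of_singL (ξ : SingL n K) : 0 < ξ.1.rank ∧ ξ.1.rank < n :=
  rank_pos_and_lt_of_singR (n := n) (K := K) ⟨ξ.1, ξ.2⟩

end Helpers

/-! ### The right orbits (`Φ`-side): `Σ_q f_ω(s_q ỹ)` integrates to zero -/

section OrbitRight

variable (ν : Measure (AdelicGroupData.gl n K).Adelic) [ν.IsHaarMeasure]

/-- **The `Φ`-side orbit function** `f_ω(ỹ) = F₁^<(x₀ ỹ) Φ(x₀ b_ω ỹ)` of a right orbit `ω` with base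
point `b_ω = P_ω E'_r`. [folklore] -/
def orbitFunR (x₀ : (AdelicGroupData.gl n K).Adelic) (s : ℂ) (Φ : Matrix (Fin n) (Fin n) (AdeleRing (𝓞 K) K) → ℂ)
    (ω : orbitRel.Quotient (GL (Fin n) K) (SingR n K)) (y : (AdelicGroupData.gl n K).Adelic) : ℂ :=
  gjTruncF n K (fun _ => (1 : ℂ)) s (x₀ * y) *
    Φ ((Units.val x₀ : Matrix (Fin n) (Fin n) (AdeleRing (𝓞 K) K)) * ratMatrix n K (SingR.base ω).1 * Units.val y)

/-- `f_ω` is Borel. [folklore] -/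
theorem measurable_orbitFunR (x₀ : (AdelicGroupData.gl n K).Adelic) (s : ℂ)
    {Φ : Matrix (Fin n) (Fin n) (AdeleRing (𝓞 K) K) → ℂ} (hΦ : Continuous Φ)
    (ω : orbitRel.Quotient (GL (Fin n) K) (SingR n K)) : Measurable (orbitFunR x₀ s Φ ω) := by
  unfold orbitFunR
  refine Measurable.mul ?_ ?_
  · have hc : Continuous fun g : GL (Fin n) (AdeleRing (𝓞 K) K) => (1 : ℂ) * ((adelicAbsDet n K g : ℝ) : ℂ) ^ s :=
      continuous_const.mul (continuous_adelicAbsDet_cpow s)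
    have hm : Measurable (gjTruncF n K (fun _ => (1 : ℂ)) s : (AdelicGroupData.gl n K).Adelic → ℂ) :=
      hc.measurable.indicator (measurableSet_detAtLeastOne (n := n) (K := K)).compl
    exact hm.comp (continuous_const.mul continuous_id).measurable
  · exact (hΦ.comp ((continuous_const.mul continuous_const).mul Units.continuous_val)).measurable

/-- **`f_ω` is invariant under the rational stabiliser `S'_r(K)`** (`E'_r γ = E'_r`, `|det γ| = 1`).
[folklore] -/
theorem orbitFunR_arith_mul (x₀ : (AdelicGroupData.gl n K).Adelic) (s : ℂ)
    (Φ : Matrix (Fin n) (Fin n) (AdeleRing (𝓞 K) K) → ℂ) (ω : orbitRel.Quotient (GL (Fin n) K) (SingR n K))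
    {r : ℕ} (hr : (SingR.base ω).1.rank = r)
    {γ : (AdelicGroupData.gl n K).Adelic} (hγ : γ ∈ stabLastAdelic n K r) (y : (AdelicGroupData.gl n K).Adelic) :
    orbitFunR x₀ s Φ ω (γ * y) = orbitFunR x₀ s Φ ω y := by
  obtain ⟨g, hg, rfl⟩ := hγ
  obtain ⟨P, hP⟩ := SingR.exists_base_eq ω
  rw [hr] at hP
  unfold orbitFunR
  congr 1
  · exact gjTruncF_one_eq_of_adelicAbsDet_eq s (adelicAbsDet_mul_arith_mul ⟨g, rfl⟩ x₀ y)
  · congr 1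
    have hval : Units.val ((AdelicGroupData.gl n K).toAdelic g * y) =
        ratMatrix n K (Units.val (α := Matrix (Fin n) (Fin n) K) g) * Units.val y := rfl
    rw [hval, ← Matrix.mul_assoc, Matrix.mul_assoc _ (ratMatrix n K (SingR.base ω).1)]
    congr 2
    show ratMatrix n K (SingR.base ω).1 * ratMatrix n K (Units.val (α := Matrix (Fin n) (Fin n) K) g) =
      ratMatrix n K (SingR.base ω).1
    rw [hP]
    simp only [ratMatrix, ← Matrix.map_mul, Matrix.mul_assoc, mem_stabLast_iff.1 hg]

/-- **`f_ω` is invariant under `N_{n-r}(𝔸_K)`** (`E'_r (1 + X) = E'_r`, `|det (1 + X)| = 1`).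
[folklore] -/
theorem orbitFunR_unipotent_mul (x₀ : (AdelicGroupData.gl n K).Adelic) (s : ℂ)
    (Φ : Matrix (Fin n) (Fin n) (AdeleRing (𝓞 K) K) → ℂ) (ω : orbitRel.Quotient (GL (Fin n) K) (SingR n K))
    {r : ℕ} (hr : (SingR.base ω).1.rank = r)
    (u : blockUnipotentGL n (n - r) K) (y : (AdelicGroupData.gl n K).Adelic) :
    orbitFunR x₀ s Φ ω ((u : (AdelicGroupData.gl n K).Adelic) * y) = orbitFunR x₀ s Φ ω y := by
  obtain ⟨P, hP⟩ := SingR.exists_base_eq ω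
  rw [hr] at hP
  obtain ⟨X, rfl⟩ := toBlockUnipotentGL_bijective.2 u
  unfold orbitFunR
  congr 1
  · exact gjTruncF_one_eq_of_adelicAbsDet_eq s (adelicAbsDet_mul_unipotent_mul (toBlockUnipotentGL n _ K X).2 x₀ y)
  · congr 1
    have hval : Units.val ((toBlockUnipotentGL n (n - r) K X : (AdelicGroupData.gl n K).Adelic) * y) =
        (1 + (X : Matrix (Fin n) (Fin n) (AdeleRing (𝓞 K) K))) * Units.val y := rfl
    rw [hval, ← Matrix.mul_assoc, Matrix.mul_assoc _ (ratMatrix n K (SingR.base ω).1)]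
    congr 2
    rw [hP]
    simp only [ratMatrix, Matrix.map_mul, map_rankStdMatrixLast, Matrix.mul_assoc, rankStdMatrixLast_mul_one_add_eq X.2]

end OrbitRight

/-! ### Representatives of `Stab \ GL_n(K)` and the per-orbit vanishing -/

section Reps

/-- **Representatives**: for a subgroup `S ≤ GL_n(K)`, the elements `s_q = (q.out)⁻¹`, `q ∈ GL_n(K)/S`,
satisfy: every `γ ∈ GL_n(K)` (inside `GL_n(𝔸_K)`) has exactly one `q` with `γ s_q⁻¹ ∈ S`. [folklore] -/
theorem existsUnique_mul_out_mem (S : Subgroup (GL (Fin n) K)) {γ : (AdelicGroupData.gl n K).Adelic}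
    (hγ : γ ∈ (AdelicGroupData.gl n K).arithmeticSubgroup) :
    ∃! q : GL (Fin n) K ⧸ S, γ * ((AdelicGroupData.gl n K).toAdelic (q.out⁻¹))⁻¹ ∈ S.map (AdelicGroupData.gl n K).toAdelic := by
  obtain ⟨g, rfl⟩ := hγ
  change GL (Fin n) K at g
  have key : ∀ q : GL (Fin n) K ⧸ S,
      (AdelicGroupData.gl n K).toAdelic g * ((AdelicGroupData.gl n K).toAdelic (q.out⁻¹))⁻¹ ∈
        S.map (AdelicGroupData.gl n K).toAdelic ↔ (QuotientGroup.mk g⁻¹ : GL (Fin n) K ⧸ S) = q := by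
    intro q
    rw [← map_inv, inv_inv, ← map_mul]
    constructor
    · rintro ⟨x, hx, hxe⟩
      have hx'' : x = g * q.out := toAdelic_gl_injective hxe
      subst hx''
      have hx' : g * q.out ∈ S := hx
      rw [← q.out_eq', QuotientGroup.eq, inv_inv]
      exact hx'
    · intro h
      refine ⟨g * q.out, ?_, rfl⟩
      have h' := h.trans q.out_eq'.symm
      rw [QuotientGroup.eq, inv_inv] at h'
      exact h'
  refine ⟨QuotientGroup.mk g⁻¹, (key _).2 rfl, fun q hq => ((key q).1 hq).symm⟩

end Reps

section VanishRight

variable (ν : Measure (AdelicGroupData.gl n K).Adelic) [ν.IsHaarMeasure]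

/-- **Per-orbit vanishing on the `Φ`-side.** For a right orbit `ω` of `GL_n(K)` on the non-zero
singular matrices (rank `r`, `0 < r < n`), a `GL_n(K)`-covering weight `w`, a continuous
`GL_n(K)`-left-invariant `ψ` satisfying the cusp conditions along all maximal parabolics, and
`Φ` continuous: if `∫ w |ψ| Σ_q |f_ω(s_q ỹ)| dν < ∞` then `∫ w(ỹ) ψ(ỹ) Σ_q f_ω(s_q ỹ) dν(ỹ) = 0`
(`integral_wt_mul_mul_tsum_eq_zero_of_period_eq_zero` with `Γ' = S'_r(K)`, `U = N_{n-r}(𝔸_K)` and the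
strict fundamental domain `blockUnipotentDomain`). This is the vanishing of the rank-`r` singular
theta terms against cusp forms, Godement–Jacquet (1972), §12 (p. 165, "the terms with `ξ` of rank
`r`, `0 < r < n`, contribute nothing since `φ` is cuspidal"). [cite: GodementJacquetLNM260, §12] -/
theorem integral_wt_mul_tsum_orbitFunR_eq_zero (x₀ : (AdelicGroupData.gl n K).Adelic) (s : ℂ)
    {Φ : Matrix (Fin n) (Fin n) (AdeleRing (𝓞 K) K) → ℂ} (hΦ : Continuous Φ)
    {w : (AdelicGroupData.gl n K).Adelic → ℝ≥0∞} (hwm : Measurable w)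
    (hw : ∀ y, coveringSum (AdelicGroupData.gl n K).arithmeticSubgroup w y = 1)
    {ψ : (AdelicGroupData.gl n K).Adelic → ℂ} (hψc : Continuous ψ)
    (hψinv : ∀ γ ∈ (AdelicGroupData.gl n K).arithmeticSubgroup, ∀ y, ψ (γ * y) = ψ y)
    (hψcusp : ∀ k, 0 < k → k < n → CuspConditionGL n K ψ k)
    (ω : orbitRel.Quotient (GL (Fin n) K) (SingR n K))
    (hint : ∫⁻ y, w y * ‖ψ y‖ₑ *
      ∑' q : GL (Fin n) K ⧸ stabilizer (GL (Fin n) K) (SingR.base ω),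
        ‖orbitFunR x₀ s Φ ω ((AdelicGroupData.gl n K).toAdelic (q.out⁻¹) * y)‖ₑ ∂ν < ⊤) :
    ∫ y, wt w y • (ψ y * ∑' q : GL (Fin n) K ⧸ stabilizer (GL (Fin n) K) (SingR.base ω),
      orbitFunR x₀ s Φ ω ((AdelicGroupData.gl n K).toAdelic (q.out⁻¹) * y)) ∂ν = 0 := by
  -- the rank and the stabiliser
  set r : ℕ := (SingR.base ω).1.rank with hr
  obtain ⟨hr0, hrn⟩ := rank_pos_and_lt_of_singR (SingR.base ω)
  rw [← hr] at hr0 hrn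
  have hk0 : 0 < n - r := Nat.sub_pos_of_lt hrn
  have hkn : n - r < n := Nat.sub_lt (lt_trans hr0 hrn) hr0
  have hstab : stabilizer (GL (Fin n) K) (SingR.base ω) = stabLast n K r := SingR.stabilizer_base ω
  -- the data of the generic vanishing theorem
  set Γ : Subgroup (AdelicGroupData.gl n K).Adelic := (AdelicGroupData.gl n K).arithmeticSubgroup with hΓ
  set Γ' : Subgroup (AdelicGroupData.gl n K).Adelic := stabLastAdelic n K r with hΓ'
  set U : Subgroup (AdelicGroupData.gl n K).Adelic := blockUnipotentGL n (n - r) K with hU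
  haveI := locallyCompactSpace_blockNilpotent n (n - r) K
  haveI : SecondCountableTopology (blockNilpotent n (n - r) (AdeleRing (𝓞 K) K)) :=
    secondCountableTopology_blockNilpotent n (n - r) K
  set μU : Measure U := blockUnipotentMeasure n (n - r) K (blockHaar n (n - r) K) with hμU
  have hle : Γ' ≤ Γ := stabLastAdelic_le r
  haveI : Countable Γ' := (Subgroup.inclusion_injective hle).countable
  haveI : Countable (Γ'.subgroupOf U) :=
    Function.Injective.countable (f := fun x : Γ'.subgroupOf U => (⟨(x : U), Subgroup.mem_subgroupOf.1 x.2⟩ : Γ'))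
      fun a b h => Subtype.ext (Subtype.ext (congrArg (fun z : Γ' => (z : (AdelicGroupData.gl n K).Adelic)) h))
  haveI : DiscreteTopology Γ' := discreteTopology_of_le_arithmeticSubgroup hle
  haveI : ν.IsMulRightInvariant := GLn.isMulRightInvariant_of_isHaarMeasure_adelic_holds n K ν inferInstance
  haveI : Countable (GL (Fin n) K) := countable_generalLinearGroup_numberField n K
  haveI : Countable (GL (Fin n) K ⧸ stabilizer (GL (Fin n) K) (SingR.base ω)) :=
    (QuotientGroup.mk_surjective (s := stabilizer (GL (Fin n) K) (SingR.base ω))).countable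
  -- a `Γ'`-weight
  obtain ⟨β₁, hβ₁m, hβ₁w⟩ := exists_isCoveringWeight Γ'
  -- hypotheses on `U`
  have hnorm : ∀ γ ∈ Γ', ∀ u ∈ U, γ * u * γ⁻¹ ∈ U := by
    rintro γ ⟨g, hg, rfl⟩ u hu
    exact conj_mem_blockUnipotentGL (stabLastParabolic hg) hu
  have hUcomm : ∀ a b : U, a * b = b * a := blockUnipotentGL_comm
  have hleft : ∀ η : Γ'.subgroupOf U, ∀ g : U → ℝ≥0∞, Measurable g →
      ∫⁻ u, g ((η : U) * u) ∂μU = ∫⁻ u, g u ∂μU := fun η g _ =>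
    lintegral_blockUnipotentMeasure_mul_left _ _ g
  have hcomm : ∀ (γ : Γ') (x : (AdelicGroupData.gl n K).Adelic) (g : (AdelicGroupData.gl n K).Adelic → ℝ≥0∞),
      Measurable g → ∫⁻ u : U, g ((γ : (AdelicGroupData.gl n K).Adelic) • (u : (AdelicGroupData.gl n K).Adelic) • x) ∂μU =
        ∫⁻ u : U, g ((u : (AdelicGroupData.gl n K).Adelic) • (γ : (AdelicGroupData.gl n K).Adelic) • x) ∂μU := by
    rintro ⟨γ, g, hg, rfl⟩ x G _
    simp only [smul_eq_mul, ← mul_assoc]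
    exact lintegral_blockUnipotentMeasure_mul_comm (blockHaar n (n - r) K) (coe_stabLastParabolic hg) G x
  have h𝓕 : ∀ u : U, ∃! η : Γ'.subgroupOf U, ((η : U) * u) ∈ blockUnipotentDomain n (n - r) K :=
    existsUnique_mul_mem_blockUnipotentDomain mem_stabLastAdelic_iff_logBlockUnipotentGL_mem
  -- representatives
  have hsΓ : ∀ q : GL (Fin n) K ⧸ stabilizer (GL (Fin n) K) (SingR.base ω),
      (AdelicGroupData.gl n K).toAdelic (q.out⁻¹) ∈ Γ := fun q => ⟨_, rfl⟩
  have hs : ∀ γ ∈ Γ, ∃! q : GL (Fin n) K ⧸ stabilizer (GL (Fin n) K) (SingR.base ω),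
      γ * ((AdelicGroupData.gl n K).toAdelic (q.out⁻¹))⁻¹ ∈ Γ' := by
    intro γ hγ
    have h := existsUnique_mul_out_mem (stabilizer (GL (Fin n) K) (SingR.base ω)) hγ
    rwa [hstab] at h ⊢
  -- the functions
  have hψcusp' : ∀ x, ∫ u in blockUnipotentDomain n (n - r) K,
      ψ ((u : (AdelicGroupData.gl n K).Adelic)⁻¹ • x) ∂μU = 0 := fun x =>
    setIntegral_blockUnipotentDomain_inv_mul_eq_zero (hψcusp (n - r) hk0 hkn) (blockHaar n (n - r) K) x
  have hfinv : ∀ γ ∈ Γ', ∀ y, orbitFunR x₀ s Φ ω (γ • y) = orbitFunR x₀ s Φ ω y := fun γ hγ y =>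
    orbitFunR_arith_mul x₀ s Φ ω hr.symm hγ y
  have hfU : ∀ u : U, ∀ y, orbitFunR x₀ s Φ ω ((u : (AdelicGroupData.gl n K).Adelic) • y) = orbitFunR x₀ s Φ ω y :=
    fun u y => orbitFunR_unipotent_mul x₀ s Φ ω hr.symm u y
  exact integral_wt_mul_mul_tsum_eq_zero_of_period_eq_zero ν Γ Γ' U μU hle hnorm hUcomm hleft hcomm
    measurableSet_blockUnipotentDomain h𝓕
    (blockUnipotentMeasure_blockUnipotentDomain_ne_zero _) (blockUnipotentMeasure_blockUnipotentDomain_ne_top _)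
    hwm hw hβ₁m hβ₁w hsΓ hs hψc.stronglyMeasurable hψinv hψcusp'
    (measurable_orbitFunR x₀ s hΦ ω).stronglyMeasurable hfinv hfU hint

end VanishRight

/-! ### The left orbits (`Φ̂`-side) -/

section OrbitLeft

/-- **The `Φ̂`-side orbit function** `f''_ω(ỹ) = F''_{n-s}(ỹ⁻¹ x₀⁻¹) Ψ(ỹ⁻¹ b_ω x₀⁻¹)` of a left orbit
`ω` with base point `b_ω = E_r Q_ω`. [folklore] -/
def orbitFunL (x₀ : (AdelicGroupData.gl n K).Adelic) (s : ℂ) (Ψ : Matrix (Fin n) (Fin n) (AdeleRing (𝓞 K) K) → ℂ)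
    (ω : orbitRel.Quotient (GL (Fin n) K) (SingL n K)) (y : (AdelicGroupData.gl n K).Adelic) : ℂ :=
  gjDualF n K (fun _ => (1 : ℂ)) ((n : ℂ) - s) (y⁻¹ * x₀⁻¹) *
    Ψ (Units.val y⁻¹ * ratMatrix n K (SingL.base ω).1 * (Units.val x₀⁻¹ : Matrix (Fin n) (Fin n) (AdeleRing (𝓞 K) K)))

/-- `f''_ω` is Borel. [folklore] -/
theorem measurable_orbitFunL (x₀ : (AdelicGroupData.gl n K).Adelic) (s : ℂ)
    {Ψ : Matrix (Fin n) (Fin n) (AdeleRing (𝓞 K) K) → ℂ} (hΨ : Continuous Ψ)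
    (ω : orbitRel.Quotient (GL (Fin n) K) (SingL n K)) : Measurable (orbitFunL x₀ s Ψ ω) := by
  unfold orbitFunL
  refine Measurable.mul ?_ ?_
  · have hc : Continuous fun g : GL (Fin n) (AdeleRing (𝓞 K) K) => (1 : ℂ) * ((adelicAbsDet n K g : ℝ) : ℂ) ^ ((n : ℂ) - s) :=
      continuous_const.mul (continuous_adelicAbsDet_cpow _)
    have hm : Measurable (gjDualF n K (fun _ => (1 : ℂ)) ((n : ℂ) - s) : (AdelicGroupData.gl n K).Adelic → ℂ) :=
      hc.measurable.indicator (isOpen_detGtOne (n := n) (K := K)).measurableSet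
    exact hm.comp (continuous_inv.mul continuous_const).measurable
  · exact (hΨ.comp (((Units.continuous_val.comp continuous_inv).mul continuous_const).mul continuous_const)).measurable

/-- **`f''_ω` is invariant under the rational stabiliser `S_r(K)`** (`γ⁻¹ E_r = E_r`, `|det γ| = 1`).
[folklore] -/
theorem orbitFunL_arith_mul (x₀ : (AdelicGroupData.gl n K).Adelic) (s : ℂ)
    (Ψ : Matrix (Fin n) (Fin n) (AdeleRing (𝓞 K) K) → ℂ) (ω : orbitRel.Quotient (GL (Fin n) K) (SingL n K))
    {r : ℕ} (hr : (SingL.base ω).1.rank = r)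
    {γ : (AdelicGroupData.gl n K).Adelic} (hγ : γ ∈ stabFirstAdelic n K r) (y : (AdelicGroupData.gl n K).Adelic) :
    orbitFunL x₀ s Ψ ω (γ * y) = orbitFunL x₀ s Ψ ω y := by
  obtain ⟨g, hg, rfl⟩ := hγ
  obtain ⟨Q, hQ⟩ := SingL.exists_base_eq ω
  rw [hr] at hQ
  unfold orbitFunL
  congr 1
  · exact gjDualF_one_eq_of_adelicAbsDet_eq _ (adelicAbsDet_arith_mul_inv_mul ⟨g, rfl⟩ x₀⁻¹ y)
  · congr 1
    have hval : Units.val ((AdelicGroupData.gl n K).toAdelic g * y)⁻¹ =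
        Units.val y⁻¹ * ratMatrix n K (Units.val (α := Matrix (Fin n) (Fin n) K) g⁻¹) := rfl
    rw [hval, Matrix.mul_assoc (Units.val y⁻¹) _ (ratMatrix n K (SingL.base ω).1)]
    congr 2
    rw [hQ]
    simp only [ratMatrix, ← Matrix.map_mul, ← Matrix.mul_assoc, mem_stabFirst_iff.1 (inv_mem hg)]

/-- **`f''_ω` is invariant under `N_r(𝔸_K)`** (`(1 - X) E_r = E_r`, `|det (1 + X)| = 1`). [folklore] -/
theorem orbitFunL_unipotent_mul (x₀ : (AdelicGroupData.gl n K).Adelic) (s : ℂ)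
    (Ψ : Matrix (Fin n) (Fin n) (AdeleRing (𝓞 K) K) → ℂ) (ω : orbitRel.Quotient (GL (Fin n) K) (SingL n K))
    {r : ℕ} (hr : (SingL.base ω).1.rank = r)
    (u : blockUnipotentGL n r K) (y : (AdelicGroupData.gl n K).Adelic) :
    orbitFunL x₀ s Ψ ω ((u : (AdelicGroupData.gl n K).Adelic) * y) = orbitFunL x₀ s Ψ ω y := by
  obtain ⟨Q, hQ⟩ := SingL.exists_base_eq ω
  rw [hr] at hQ
  obtain ⟨X, rfl⟩ := toBlockUnipotentGL_bijective.2 u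
  unfold orbitFunL
  congr 1
  · exact gjDualF_one_eq_of_adelicAbsDet_eq _ (adelicAbsDet_unipotent_mul_inv_mul (toBlockUnipotentGL n _ K X).2 x₀⁻¹ y)
  · congr 1
    have hval : Units.val ((toBlockUnipotentGL n r K X : (AdelicGroupData.gl n K).Adelic) * y)⁻¹ =
        Units.val y⁻¹ * (1 - (X : Matrix (Fin n) (Fin n) (AdeleRing (𝓞 K) K))) := rfl
    have hXE : (1 - (X : Matrix (Fin n) (Fin n) (AdeleRing (𝓞 K) K))) * rankStdMatrix n r (AdeleRing (𝓞 K) K) =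
        rankStdMatrix n r (AdeleRing (𝓞 K) K) := by
      have h := one_add_mul_rankStdMatrix_eq (R := AdeleRing (𝓞 K) K) (n := n) (r := r)
        (X := -(X : Matrix (Fin n) (Fin n) (AdeleRing (𝓞 K) K))) (fun i j hij => X.2 i j (by simpa using hij))
      simpa [sub_eq_add_neg] using h
    rw [hval, Matrix.mul_assoc (Units.val y⁻¹) _ (ratMatrix n K (SingL.base ω).1)]
    congr 2
    rw [hQ]
    simp only [ratMatrix, Matrix.map_mul, map_rankStdMatrix, ← Matrix.mul_assoc, hXE]

end OrbitLeft

section VanishLeft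

variable (ν : Measure (AdelicGroupData.gl n K).Adelic) [ν.IsHaarMeasure]

/-- **Per-orbit vanishing on the `Φ̂`-side** (left orbits, `Γ' = S_r(K) ⊆ P_r`, `U = N_r(𝔸_K)`): the
analogue of `integral_wt_mul_tsum_orbitFunR_eq_zero` for the reflected singular theta terms.
[cite: GodementJacquetLNM260, §12] -/
theorem integral_wt_mul_tsum_orbitFunL_eq_zero (x₀ : (AdelicGroupData.gl n K).Adelic) (s : ℂ)
    {Ψ : Matrix (Fin n) (Fin n) (AdeleRing (𝓞 K) K) → ℂ} (hΨ : Continuous Ψ)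
    {w : (AdelicGroupData.gl n K).Adelic → ℝ≥0∞} (hwm : Measurable w)
    (hw : ∀ y, coveringSum (AdelicGroupData.gl n K).arithmeticSubgroup w y = 1)
    {ψ : (AdelicGroupData.gl n K).Adelic → ℂ} (hψc : Continuous ψ)
    (hψinv : ∀ γ ∈ (AdelicGroupData.gl n K).arithmeticSubgroup, ∀ y, ψ (γ * y) = ψ y)
    (hψcusp : ∀ k, 0 < k → k < n → CuspConditionGL n K ψ k)
    (ω : orbitRel.Quotient (GL (Fin n) K) (SingL n K))
    (hint : ∫⁻ y, w y * ‖ψ y‖ₑ *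
      ∑' q : GL (Fin n) K ⧸ stabilizer (GL (Fin n) K) (SingL.base ω),
        ‖orbitFunL x₀ s Ψ ω ((AdelicGroupData.gl n K).toAdelic (q.out⁻¹) * y)‖ₑ ∂ν < ⊤) :
    ∫ y, wt w y • (ψ y * ∑' q : GL (Fin n) K ⧸ stabilizer (GL (Fin n) K) (SingL.base ω),
      orbitFunL x₀ s Ψ ω ((AdelicGroupData.gl n K).toAdelic (q.out⁻¹) * y)) ∂ν = 0 := by
  set r : ℕ := (SingL.base ω).1.rank with hr
  obtain ⟨hr0, hrn⟩ := rank_pos_and_lt_of_singL (SingL.base ω)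
  rw [← hr] at hr0 hrn
  have hstab : stabilizer (GL (Fin n) K) (SingL.base ω) = stabFirst n K r := SingL.stabilizer_base ω
  set Γ : Subgroup (AdelicGroupData.gl n K).Adelic := (AdelicGroupData.gl n K).arithmeticSubgroup with hΓ
  set Γ' : Subgroup (AdelicGroupData.gl n K).Adelic := stabFirstAdelic n K r with hΓ'
  set U : Subgroup (AdelicGroupData.gl n K).Adelic := blockUnipotentGL n r K with hU
  haveI := locallyCompactSpace_blockNilpotent n r K
  haveI : SecondCountableTopology (blockNilpotent n r (AdeleRing (𝓞 K) K)) :=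
    secondCountableTopology_blockNilpotent n r K
  set μU : Measure U := blockUnipotentMeasure n r K (blockHaar n r K) with hμU
  have hle : Γ' ≤ Γ := stabFirstAdelic_le r
  haveI : Countable Γ' := (Subgroup.inclusion_injective hle).countable
  haveI : Countable (Γ'.subgroupOf U) :=
    Function.Injective.countable (f := fun x : Γ'.subgroupOf U => (⟨(x : U), Subgroup.mem_subgroupOf.1 x.2⟩ : Γ'))
      fun a b h => Subtype.ext (Subtype.ext (congrArg (fun z : Γ' => (z : (AdelicGroupData.gl n K).Adelic)) h))
  haveI : DiscreteTopology Γ' := discreteTopology_of_le_arithmeticSubgroup hle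
  haveI : ν.IsMulRightInvariant := GLn.isMulRightInvariant_of_isHaarMeasure_adelic_holds n K ν inferInstance
  haveI : Countable (GL (Fin n) K) := countable_generalLinearGroup_numberField n K
  haveI : Countable (GL (Fin n) K ⧸ stabilizer (GL (Fin n) K) (SingL.base ω)) :=
    (QuotientGroup.mk_surjective (s := stabilizer (GL (Fin n) K) (SingL.base ω))).countable
  obtain ⟨β₁, hβ₁m, hβ₁w⟩ := exists_isCoveringWeight Γ'
  have hnorm : ∀ γ ∈ Γ', ∀ u ∈ U, γ * u * γ⁻¹ ∈ U := by
    rintro γ ⟨g, hg, rfl⟩ u hu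
    exact conj_mem_blockUnipotentGL (stabFirstParabolic hg) hu
  have hUcomm : ∀ a b : U, a * b = b * a := blockUnipotentGL_comm
  have hleft : ∀ η : Γ'.subgroupOf U, ∀ g : U → ℝ≥0∞, Measurable g →
      ∫⁻ u, g ((η : U) * u) ∂μU = ∫⁻ u, g u ∂μU := fun η g _ =>
    lintegral_blockUnipotentMeasure_mul_left _ _ g
  have hcomm : ∀ (γ : Γ') (x : (AdelicGroupData.gl n K).Adelic) (g : (AdelicGroupData.gl n K).Adelic → ℝ≥0∞),
      Measurable g → ∫⁻ u : U, g ((γ : (AdelicGroupData.gl n K).Adelic) • (u : (AdelicGroupData.gl n K).Adelic) • x) ∂μU =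
        ∫⁻ u : U, g ((u : (AdelicGroupData.gl n K).Adelic) • (γ : (AdelicGroupData.gl n K).Adelic) • x) ∂μU := by
    rintro ⟨γ, g, hg, rfl⟩ x G _
    simp only [smul_eq_mul, ← mul_assoc]
    exact lintegral_blockUnipotentMeasure_mul_comm (blockHaar n r K) (coe_stabFirstParabolic hg) G x
  have h𝓕 : ∀ u : U, ∃! η : Γ'.subgroupOf U, ((η : U) * u) ∈ blockUnipotentDomain n r K :=
    existsUnique_mul_mem_blockUnipotentDomain mem_stabFirstAdelic_iff_logBlockUnipotentGL_mem
  have hsΓ : ∀ q : GL (Fin n) K ⧸ stabilizer (GL (Fin n) K) (SingL.base ω),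
      (AdelicGroupData.gl n K).toAdelic (q.out⁻¹) ∈ Γ := fun q => ⟨_, rfl⟩
  have hs : ∀ γ ∈ Γ, ∃! q : GL (Fin n) K ⧸ stabilizer (GL (Fin n) K) (SingL.base ω),
      γ * ((AdelicGroupData.gl n K).toAdelic (q.out⁻¹))⁻¹ ∈ Γ' := by
    intro γ hγ
    have h := existsUnique_mul_out_mem (stabilizer (GL (Fin n) K) (SingL.base ω)) hγ
    rwa [hstab] at h ⊢
  have hψcusp' : ∀ x, ∫ u in blockUnipotentDomain n r K,
      ψ ((u : (AdelicGroupData.gl n K).Adelic)⁻¹ • x) ∂μU = 0 := fun x =>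
    setIntegral_blockUnipotentDomain_inv_mul_eq_zero (hψcusp r hr0 hrn) (blockHaar n r K) x
  have hfinv : ∀ γ ∈ Γ', ∀ y, orbitFunL x₀ s Ψ ω (γ • y) = orbitFunL x₀ s Ψ ω y := fun γ hγ y =>
    orbitFunL_arith_mul x₀ s Ψ ω hr.symm hγ y
  have hfU : ∀ u : U, ∀ y, orbitFunL x₀ s Ψ ω ((u : (AdelicGroupData.gl n K).Adelic) • y) = orbitFunL x₀ s Ψ ω y :=
    fun u y => orbitFunL_unipotent_mul x₀ s Ψ ω hr.symm u y
  exact integral_wt_mul_mul_tsum_eq_zero_of_period_eq_zero ν Γ Γ' U μU hle hnorm hUcomm hleft hcomm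
    measurableSet_blockUnipotentDomain h𝓕
    (blockUnipotentMeasure_blockUnipotentDomain_ne_zero _) (blockUnipotentMeasure_blockUnipotentDomain_ne_top _)
    hwm hw hβ₁m hβ₁w hsΓ hs hψc.stronglyMeasurable hψinv hψcusp'
    (measurable_orbitFunL x₀ s hΨ ω).stronglyMeasurable hfinv hfU hint

end VanishLeft

/-! ### Summing over the orbits -/

section Summation

variable (ν : Measure (AdelicGroupData.gl n K).Adelic) [ν.IsHaarMeasure]

omit [ν.IsHaarMeasure] in
/-- **Vanishing survives a countable sum of families.** If for every `ω` the integral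
`∫ w ψ Σ_i F_ω^i dν` vanishes as soon as `∫ w |ψ| Σ_i |F_ω^i| dν < ∞`, the `F_ω^i` are Borel, and
`∫ w |ψ| Σ_ω Σ_i |F_ω^i| dν < ∞`, then `∫ w(y) ψ(y) Σ_ω Σ_i F_ω^i(y) dν(y) = 0`
(`integral_tsum` over `ω`). [folklore] -/
theorem integral_wt_mul_tsum_tsum_eq_zero {Ω : Type*} [Countable Ω] {ι : Ω → Type*} [∀ ω, Countable (ι ω)]
    {w : (AdelicGroupData.gl n K).Adelic → ℝ≥0∞} (hwm : Measurable w)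
    {ψ : (AdelicGroupData.gl n K).Adelic → ℂ} (hψm : Measurable ψ)
    (F : ∀ ω, ι ω → (AdelicGroupData.gl n K).Adelic → ℂ) (hFm : ∀ ω i, Measurable (F ω i))
    (hzero : ∀ ω, ∫⁻ y, w y * ‖ψ y‖ₑ * ∑' i, ‖F ω i y‖ₑ ∂ν < ⊤ →
      ∫ y, wt w y • (ψ y * ∑' i, F ω i y) ∂ν = 0)
    (hint : ∫⁻ y, w y * ‖ψ y‖ₑ * ∑' ω, ∑' i, ‖F ω i y‖ₑ ∂ν < ⊤) :
    ∫ y, wt w y • (ψ y * ∑' ω, ∑' i, F ω i y) ∂ν = 0 := by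
  -- the summands, as functions of `y`
  set Fω : Ω → (AdelicGroupData.gl n K).Adelic → ℂ := fun ω y => wt w y • (ψ y * ∑' i, F ω i y) with hFω
  have hgm : ∀ ω, Measurable fun y => ∑' i, F ω i y := fun ω => Measurable.tsum fun i => hFm ω i
  have hwt : Measurable (wt w) := ENNReal.measurable_toReal.comp hwm
  have hFωm : ∀ ω, AEStronglyMeasurable (Fω ω) ν := fun ω =>
    (hwt.smul (hψm.mul (hgm ω))).aestronglyMeasurable
  -- pointwise bounds
  have hwt_le : ∀ y, (‖wt w y‖ₑ : ℝ≥0∞) ≤ w y := fun y => by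
    rw [wt, Real.enorm_eq_ofReal ENNReal.toReal_nonneg]
    exact ENNReal.ofReal_toReal_le
  have hbound : ∀ ω y, (‖Fω ω y‖ₑ : ℝ≥0∞) ≤ w y * ‖ψ y‖ₑ * ∑' i, ‖F ω i y‖ₑ := fun ω y => by
    simp only [hFω, enorm_smul, enorm_mul]
    calc (‖wt w y‖ₑ : ℝ≥0∞) * (‖ψ y‖ₑ * ‖∑' i, F ω i y‖ₑ)
        ≤ w y * (‖ψ y‖ₑ * ∑' i, ‖F ω i y‖ₑ) :=
          mul_le_mul' (hwt_le y) (mul_le_mul_right (enorm_tsum_le_tsum_enorm) _)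
      _ = w y * ‖ψ y‖ₑ * ∑' i, ‖F ω i y‖ₑ := (mul_assoc _ _ _).symm
  -- the sum of the majorants is finite
  have hmeas_maj : ∀ ω, Measurable fun y => w y * ‖ψ y‖ₑ * ∑' i, (‖F ω i y‖ₑ : ℝ≥0∞) := fun ω =>
    (hwm.mul hψm.enorm).mul (Measurable.tsum fun i => (hFm ω i).enorm)
  have hsum_maj : ∑' ω, ∫⁻ y, w y * ‖ψ y‖ₑ * ∑' i, (‖F ω i y‖ₑ : ℝ≥0∞) ∂ν < ⊤ := by
    rw [← lintegral_tsum fun ω => (hmeas_maj ω).aemeasurable]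
    refine lt_of_le_of_lt (lintegral_mono fun y => le_of_eq ?_) hint
    rw [← ENNReal.tsum_mul_left]
  have hfin : ∀ ω, ∫⁻ y, w y * ‖ψ y‖ₑ * ∑' i, (‖F ω i y‖ₑ : ℝ≥0∞) ∂ν < ⊤ := fun ω =>
    lt_of_le_of_lt (ENNReal.le_tsum ω) hsum_maj
  have hf' : ∑' ω, ∫⁻ y, ‖Fω ω y‖ₑ ∂ν ≠ ⊤ :=
    (lt_of_le_of_lt (ENNReal.tsum_le_tsum fun ω => lintegral_mono fun y => hbound ω y) hsum_maj).ne
  -- `∫ Σ_ω = Σ_ω ∫ = Σ_ω 0`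
  have hpt : ∀ y, wt w y • (ψ y * ∑' ω, ∑' i, F ω i y) = ∑' ω, Fω ω y := fun y => by
    simp only [hFω, Complex.real_smul]
    rw [← tsum_mul_left, ← tsum_mul_left]
  simp_rw [hpt]
  rw [integral_tsum hFωm hf']
  refine (tsum_congr fun ω => ?_).trans tsum_zero
  exact hzero ω (hfin ω)

end Summation

/-! ### Orbit decomposition of sums (general and normed versions) -/

section OrbitSums

omit [NumberField K]

/-- `Σ_{x ∈ G b} h(x) = Σ_{q ∈ G/Stab(b)} h(q.out • b)` in any topological additive monoid
(orbit–stabiliser; no summability needed). [folklore] -/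
theorem tsum_orbit_eq_tsum_quotient' {G X E : Type*} [Group G] [MulAction G X] [AddCommMonoid E] [TopologicalSpace E]
    (b : X) (h : X → E) :
    ∑' x : orbit G b, h x = ∑' q : G ⧸ stabilizer G b, h (q.out • b) := by
  rw [← (orbitEquivQuotientStabilizer G b).symm.tsum_eq]
  refine tsum_congr fun q => ?_
  conv_lhs => rw [← q.out_eq']
  rfl

/-- `Σ_{x ∈ ω} h(x) = Σ_q h(q.out • b_ω)` for a right orbit `ω`. [folklore] -/
theorem SingR.tsum_orbit_eq {F E : Type*} [Field F] [AddCommMonoid E] [TopologicalSpace E]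
    (ω : orbitRel.Quotient (GL (Fin n) F) (SingR n F)) (h : SingR n F → E) :
    ∑' x : ω.orbit, h x = ∑' q : GL (Fin n) F ⧸ stabilizer (GL (Fin n) F) (SingR.base ω), h (q.out • SingR.base ω) := by
  rw [tsum_congr_set_coe h (SingR.orbit_eq ω)]
  exact tsum_orbit_eq_tsum_quotient' _ h

/-- `Σ_{x ∈ ω} h(x) = Σ_q h(q.out • b_ω)` for a left orbit `ω`. [folklore] -/
theorem SingL.tsum_orbit_eq {F E : Type*} [Field F] [AddCommMonoid E] [TopologicalSpace E]
    (ω : orbitRel.Quotient (GL (Fin n) F) (SingL n F)) (h : SingL n F → E) :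
    ∑' x : ω.orbit, h x = ∑' q : GL (Fin n) F ⧸ stabilizer (GL (Fin n) F) (SingL.base ω), h (q.out • SingL.base ω) := by
  rw [tsum_congr_set_coe h (SingL.orbit_eq ω)]
  exact tsum_orbit_eq_tsum_quotient' _ h

/-- **`Σ_ξ h(ξ) = Σ_ω Σ_{x ∈ ω} h(x)` for a norm-summable family** on any type with a group action
(complete normed target). [folklore] -/
theorem tsum_eq_tsum_orbits_of_summable_norm {G X E : Type*} [Group G] [MulAction G X]
    [NormedAddCommGroup E] [CompleteSpace E] (h : X → E) (hs : Summable fun x => ‖h x‖) :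
    ∑' x, h x = ∑' ω : orbitRel.Quotient G X, ∑' x : ω.orbit, h x := by
  set e := selfEquivSigmaOrbits' G X with he
  have hsymm : ∀ p : Σ ω : orbitRel.Quotient G X, ω.orbit, e.symm p = (p.2 : X) := fun p => rfl
  rw [← e.symm.tsum_eq]
  have h2 : Summable fun p : Σ ω : orbitRel.Quotient G X, ω.orbit => h (e.symm p) :=
    (hs.of_norm.comp_injective e.symm.injective)
  rw [h2.tsum_sigma]
  rfl

/-- The `ℝ≥0∞` version (no hypothesis). [folklore] -/
theorem tsum_eq_tsum_orbits_ennreal {G X : Type*} [Group G] [MulAction G X] (h : X → ℝ≥0∞) :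
    ∑' x, h x = ∑' ω : orbitRel.Quotient G X, ∑' x : ω.orbit, h x := by
  rw [← (selfEquivSigmaOrbits' G X).symm.tsum_eq, ENNReal.tsum_sigma']
  rfl

end OrbitSums


/-! ### The full singular sums: `Σ_{ξ ∈ T} = Σ_ω Σ_{x ∈ ω}` and the vanishing -/

section Total

variable (ν : Measure (AdelicGroupData.gl n K).Adelic) [ν.IsHaarMeasure]

omit [NumberField K] in
/-- `SingR n K` is countable. [folklore] -/
theorem countable_singR [NumberField K] : Countable (SingR n K) := by
  haveI : Countable K := NumberField.countable' (K := K)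
  haveI : Countable (Matrix (Fin n) (Fin n) K) := inferInstanceAs (Countable (Fin n → Fin n → K))
  exact Subtype.countable

omit [NumberField K] in
/-- `SingL n K` is countable. [folklore] -/
theorem countable_singL [NumberField K] : Countable (SingL n K) := by
  haveI : Countable K := NumberField.countable' (K := K)
  haveI : Countable (Matrix (Fin n) (Fin n) K) := inferInstanceAs (Countable (Fin n → Fin n → K))
  exact Subtype.countable

/-- **The `Φ`-side singular term** `F₁^<(x₀ ỹ) Φ(x₀ ξ ỹ)`, `ξ` non-zero singular. [folklore] -/
def singTermR (x₀ : (AdelicGroupData.gl n K).Adelic) (s : ℂ) (Φ : Matrix (Fin n) (Fin n) (AdeleRing (𝓞 K) K) → ℂ)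
    (y : (AdelicGroupData.gl n K).Adelic) (ξ : SingR n K) : ℂ :=
  gjTruncF n K (fun _ => (1 : ℂ)) s (x₀ * y) *
    Φ ((Units.val x₀ : Matrix (Fin n) (Fin n) (AdeleRing (𝓞 K) K)) * ratMatrix n K ξ.1 * Units.val y)

/-- **The `Φ̂`-side singular term** `F''(ỹ⁻¹ x₀⁻¹) Ψ(ỹ⁻¹ ξ x₀⁻¹)`, `ξ` non-zero singular. [folklore] -/
def singTermL (x₀ : (AdelicGroupData.gl n K).Adelic) (s : ℂ) (Ψ : Matrix (Fin n) (Fin n) (AdeleRing (𝓞 K) K) → ℂ)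
    (y : (AdelicGroupData.gl n K).Adelic) (ξ : SingL n K) : ℂ :=
  gjDualF n K (fun _ => (1 : ℂ)) ((n : ℂ) - s) (y⁻¹ * x₀⁻¹) *
    Ψ (Units.val y⁻¹ * ratMatrix n K ξ.1 * (Units.val x₀⁻¹ : Matrix (Fin n) (Fin n) (AdeleRing (𝓞 K) K)))

/-- **Terms along an orbit are values of the orbit function at the representatives**:
`F₁(x₀ ỹ) Φ(x₀ (γ • b_ω) ỹ) = f_ω(γ⁻¹ ỹ)`. [folklore] -/
theorem singTermR_smul_base (x₀ : (AdelicGroupData.gl n K).Adelic) (s : ℂ)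
    (Φ : Matrix (Fin n) (Fin n) (AdeleRing (𝓞 K) K) → ℂ) (ω : orbitRel.Quotient (GL (Fin n) K) (SingR n K))
    (γ : GL (Fin n) K) (y : (AdelicGroupData.gl n K).Adelic) :
    singTermR x₀ s Φ y (γ • SingR.base ω) = orbitFunR x₀ s Φ ω ((AdelicGroupData.gl n K).toAdelic γ⁻¹ * y) := by
  unfold singTermR orbitFunR
  congr 1
  · exact (gjTruncF_one_eq_of_adelicAbsDet_eq s (adelicAbsDet_mul_arith_mul ⟨γ⁻¹, rfl⟩ x₀ y)).symm
  · congr 1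
    have hval : Units.val ((AdelicGroupData.gl n K).toAdelic γ⁻¹ * y) =
        ratMatrix n K (Units.val (α := Matrix (Fin n) (Fin n) K) γ⁻¹) * Units.val y := rfl
    rw [hval, SingR.coe_smul]
    simp only [ratMatrix, Matrix.map_mul, Matrix.mul_assoc]

/-- `F''(ỹ⁻¹ x₀⁻¹) Ψ(ỹ⁻¹ (γ • b_ω) x₀⁻¹) = f''_ω(γ⁻¹ ỹ)`. [folklore] -/
theorem singTermL_smul_base (x₀ : (AdelicGroupData.gl n K).Adelic) (s : ℂ)
    (Ψ : Matrix (Fin n) (Fin n) (AdeleRing (𝓞 K) K) → ℂ) (ω : orbitRel.Quotient (GL (Fin n) K) (SingL n K))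
    (γ : GL (Fin n) K) (y : (AdelicGroupData.gl n K).Adelic) :
    singTermL x₀ s Ψ y (γ • SingL.base ω) = orbitFunL x₀ s Ψ ω ((AdelicGroupData.gl n K).toAdelic γ⁻¹ * y) := by
  unfold singTermL orbitFunL
  congr 1
  · exact (gjDualF_one_eq_of_adelicAbsDet_eq _ (adelicAbsDet_arith_mul_inv_mul ⟨γ⁻¹, rfl⟩ x₀⁻¹ y)).symm
  · congr 1
    have hval : Units.val ((AdelicGroupData.gl n K).toAdelic γ⁻¹ * y)⁻¹ =
        Units.val y⁻¹ * ratMatrix n K (Units.val (α := Matrix (Fin n) (Fin n) K) γ) := rfl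
    rw [hval, SingL.coe_smul]
    simp only [ratMatrix, Matrix.map_mul, Matrix.mul_assoc]

/-- Measurability of the terms in `ỹ`. [folklore] -/
theorem measurable_singTermR (x₀ : (AdelicGroupData.gl n K).Adelic) (s : ℂ)
    {Φ : Matrix (Fin n) (Fin n) (AdeleRing (𝓞 K) K) → ℂ} (hΦ : Continuous Φ) (ξ : SingR n K) :
    Measurable fun y => singTermR x₀ s Φ y ξ := by
  unfold singTermR
  refine Measurable.mul ?_ ?_
  · have hc : Continuous fun g : GL (Fin n) (AdeleRing (𝓞 K) K) => (1 : ℂ) * ((adelicAbsDet n K g : ℝ) : ℂ) ^ s :=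
      continuous_const.mul (continuous_adelicAbsDet_cpow s)
    have hm : Measurable (gjTruncF n K (fun _ => (1 : ℂ)) s : (AdelicGroupData.gl n K).Adelic → ℂ) :=
      hc.measurable.indicator (measurableSet_detAtLeastOne (n := n) (K := K)).compl
    exact hm.comp (continuous_const.mul continuous_id).measurable
  · exact (hΦ.comp ((continuous_const.mul continuous_const).mul Units.continuous_val)).measurable

/-- Measurability of the `Φ̂`-side terms in `ỹ`. [folklore] -/
theorem measurable_singTermL (x₀ : (AdelicGroupData.gl n K).Adelic) (s : ℂ)
    {Ψ : Matrix (Fin n) (Fin n) (AdeleRing (𝓞 K) K) → ℂ} (hΨ : Continuous Ψ) (ξ : SingL n K) :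
    Measurable fun y => singTermL x₀ s Ψ y ξ := by
  unfold singTermL
  refine Measurable.mul ?_ ?_
  · have hc : Continuous fun g : GL (Fin n) (AdeleRing (𝓞 K) K) => (1 : ℂ) * ((adelicAbsDet n K g : ℝ) : ℂ) ^ ((n : ℂ) - s) :=
      continuous_const.mul (continuous_adelicAbsDet_cpow _)
    have hm : Measurable (gjDualF n K (fun _ => (1 : ℂ)) ((n : ℂ) - s) : (AdelicGroupData.gl n K).Adelic → ℂ) :=
      hc.measurable.indicator (isOpen_detGtOne (n := n) (K := K)).measurableSet
    exact hm.comp (continuous_inv.mul continuous_const).measurable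
  · exact (hΨ.comp (((Units.continuous_val.comp continuous_inv).mul continuous_const).mul continuous_const)).measurable

/-- Norm-summability of the `Φ`-side terms over the non-zero singular matrices. [folklore] -/
theorem summable_norm_singTermR (x₀ : (AdelicGroupData.gl n K).Adelic) (s : ℂ)
    {Φ : Matrix (Fin n) (Fin n) (AdeleRing (𝓞 K) K) → ℂ} (hΦ : Φ ∈ schwartzBruhatAdelicMatrix n K)
    (y : (AdelicGroupData.gl n K).Adelic) : Summable fun ξ : SingR n K => ‖singTermR x₀ s Φ y ξ‖ := by
  have h := ((summable_norm_gjThetaTerm hΦ x₀ y).mul_left ‖gjTruncF n K (fun _ => (1 : ℂ)) s (x₀ * y)‖).subtype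
    {ξ : Matrix (Fin n) (Fin n) K | ¬ IsUnit ξ ∧ ξ ≠ 0}
  refine h.congr fun ξ => ?_
  simp only [Function.comp_apply, singTermR, norm_mul]

/-- Norm-summability of the `Φ̂`-side terms. [folklore] -/
theorem summable_norm_singTermL (x₀ : (AdelicGroupData.gl n K).Adelic) (s : ℂ)
    {Ψ : Matrix (Fin n) (Fin n) (AdeleRing (𝓞 K) K) → ℂ} (hΨ : Ψ ∈ schwartzBruhatAdelicMatrix n K)
    (y : (AdelicGroupData.gl n K).Adelic) : Summable fun ξ : SingL n K => ‖singTermL x₀ s Ψ y ξ‖ := by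
  have h := ((summable_norm_gjThetaTerm hΨ y⁻¹ x₀⁻¹).mul_left
    ‖gjDualF n K (fun _ => (1 : ℂ)) ((n : ℂ) - s) (y⁻¹ * x₀⁻¹)‖).subtype
    {ξ : Matrix (Fin n) (Fin n) K | ¬ IsUnit ξ ∧ ξ ≠ 0}
  refine h.congr fun ξ => ?_
  simp only [Function.comp_apply, singTermL, norm_mul]

/-- **The `Φ`-side singular theta term integrates to zero against a cusp form.** For
`Φ ∈ 𝒮(M_n(𝔸_K))`, a `GL_n(K)`-covering weight `w`, a continuous left-`GL_n(K)`-invariant `ψ`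
with the cusp conditions along all maximal parabolics, and absolute convergence
`∫ w |ψ| Σ_{ξ} |F₁(x₀ ỹ) Φ(x₀ ξ ỹ)| dν < ∞` (sum over non-zero singular `ξ`):
`∫ w(ỹ) ψ(ỹ) F₁(x₀ ỹ) Σ_ξ Φ(x₀ ξ ỹ) dν(ỹ) = 0` — the sum is regrouped along the `GL_n(K)`-orbits
(`tsum_eq_tsum_orbits_of_summable_norm`), the integral is exchanged with the sum over orbits
(`integral_wt_mul_tsum_tsum_eq_zero`), and each orbit contributes zero
(`integral_wt_mul_tsum_orbitFunR_eq_zero`). Godement–Jacquet (1972), §12.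
[cite: GodementJacquetLNM260, §12] -/
theorem integral_wt_mul_tsum_singTermR_eq_zero (x₀ : (AdelicGroupData.gl n K).Adelic) (s : ℂ)
    {Φ : Matrix (Fin n) (Fin n) (AdeleRing (𝓞 K) K) → ℂ} (hΦ : Φ ∈ schwartzBruhatAdelicMatrix n K) (hΦc : Continuous Φ)
    {w : (AdelicGroupData.gl n K).Adelic → ℝ≥0∞} (hwm : Measurable w)
    (hw : ∀ y, coveringSum (AdelicGroupData.gl n K).arithmeticSubgroup w y = 1)
    {ψ : (AdelicGroupData.gl n K).Adelic → ℂ} (hψc : Continuous ψ)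
    (hψinv : ∀ γ ∈ (AdelicGroupData.gl n K).arithmeticSubgroup, ∀ y, ψ (γ * y) = ψ y)
    (hψcusp : ∀ k, 0 < k → k < n → CuspConditionGL n K ψ k)
    (hint : ∫⁻ y, w y * ‖ψ y‖ₑ * ∑' ξ : SingR n K, ‖singTermR x₀ s Φ y ξ‖ₑ ∂ν < ⊤) :
    ∫ y, wt w y • (ψ y * ∑' ξ : SingR n K, singTermR x₀ s Φ y ξ) ∂ν = 0 := by
  haveI : Countable (SingR n K) := countable_singR
  haveI : Countable (GL (Fin n) K) := countable_generalLinearGroup_numberField n K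
  -- regroup along the orbits
  have hpt : ∀ y, ∑' ξ : SingR n K, singTermR x₀ s Φ y ξ =
      ∑' ω : orbitRel.Quotient (GL (Fin n) K) (SingR n K), ∑' x : ω.orbit, singTermR x₀ s Φ y x := fun y =>
    tsum_eq_tsum_orbits_of_summable_norm _ (summable_norm_singTermR x₀ s hΦ y)
  simp_rw [hpt]
  refine integral_wt_mul_tsum_tsum_eq_zero ν hwm hψc.measurable
    (fun (ω : orbitRel.Quotient (GL (Fin n) K) (SingR n K)) (x : ω.orbit) y => singTermR x₀ s Φ y x)
    (fun ω x => measurable_singTermR x₀ s hΦc _) (fun ω hfin => ?_) ?_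
  · -- one orbit
    have h1 : ∀ y, ∑' x : ω.orbit, singTermR x₀ s Φ y x =
        ∑' q : GL (Fin n) K ⧸ stabilizer (GL (Fin n) K) (SingR.base ω),
          orbitFunR x₀ s Φ ω ((AdelicGroupData.gl n K).toAdelic (q.out⁻¹) * y) := fun y => by
      rw [SingR.tsum_orbit_eq ω (fun ξ => singTermR x₀ s Φ y ξ)]
      exact tsum_congr fun q => singTermR_smul_base x₀ s Φ ω q.out y
    have h2 : ∀ y, ∑' x : ω.orbit, (‖singTermR x₀ s Φ y x‖ₑ : ℝ≥0∞) =
        ∑' q : GL (Fin n) K ⧸ stabilizer (GL (Fin n) K) (SingR.base ω),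
          ‖orbitFunR x₀ s Φ ω ((AdelicGroupData.gl n K).toAdelic (q.out⁻¹) * y)‖ₑ := fun y => by
      rw [SingR.tsum_orbit_eq ω (fun ξ => (‖singTermR x₀ s Φ y ξ‖ₑ : ℝ≥0∞))]
      exact tsum_congr fun q => by rw [singTermR_smul_base x₀ s Φ ω q.out y]
    simp_rw [h1]
    simp_rw [h2] at hfin
    exact integral_wt_mul_tsum_orbitFunR_eq_zero ν x₀ s hΦc hwm hw hψc hψinv hψcusp ω hfin
  · -- the total majorant
    refine lt_of_le_of_lt (lintegral_mono fun y => le_of_eq ?_) hint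
    rw [← tsum_eq_tsum_orbits_ennreal (G := GL (Fin n) K) fun ξ : SingR n K => (‖singTermR x₀ s Φ y ξ‖ₑ : ℝ≥0∞)]

/-- **The `Φ̂`-side singular theta term integrates to zero against a cusp form** (left orbits).
[cite: GodementJacquetLNM260, §12] -/
theorem integral_wt_mul_tsum_singTermL_eq_zero (x₀ : (AdelicGroupData.gl n K).Adelic) (s : ℂ)
    {Ψ : Matrix (Fin n) (Fin n) (AdeleRing (𝓞 K) K) → ℂ} (hΨ : Ψ ∈ schwartzBruhatAdelicMatrix n K) (hΨc : Continuous Ψ)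
    {w : (AdelicGroupData.gl n K).Adelic → ℝ≥0∞} (hwm : Measurable w)
    (hw : ∀ y, coveringSum (AdelicGroupData.gl n K).arithmeticSubgroup w y = 1)
    {ψ : (AdelicGroupData.gl n K).Adelic → ℂ} (hψc : Continuous ψ)
    (hψinv : ∀ γ ∈ (AdelicGroupData.gl n K).arithmeticSubgroup, ∀ y, ψ (γ * y) = ψ y)
    (hψcusp : ∀ k, 0 < k → k < n → CuspConditionGL n K ψ k)
    (hint : ∫⁻ y, w y * ‖ψ y‖ₑ * ∑' ξ : SingL n K, ‖singTermL x₀ s Ψ y ξ‖ₑ ∂ν < ⊤) :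
    ∫ y, wt w y • (ψ y * ∑' ξ : SingL n K, singTermL x₀ s Ψ y ξ) ∂ν = 0 := by
  haveI : Countable (SingL n K) := countable_singL
  haveI : Countable (GL (Fin n) K) := countable_generalLinearGroup_numberField n K
  have hpt : ∀ y, ∑' ξ : SingL n K, singTermL x₀ s Ψ y ξ =
      ∑' ω : orbitRel.Quotient (GL (Fin n) K) (SingL n K), ∑' x : ω.orbit, singTermL x₀ s Ψ y x := fun y =>
    tsum_eq_tsum_orbits_of_summable_norm _ (summable_norm_singTermL x₀ s hΨ y)
  simp_rw [hpt]
  refine integral_wt_mul_tsum_tsum_eq_zero ν hwm hψc.measurable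
    (fun (ω : orbitRel.Quotient (GL (Fin n) K) (SingL n K)) (x : ω.orbit) y => singTermL x₀ s Ψ y x)
    (fun ω x => measurable_singTermL x₀ s hΨc _) (fun ω hfin => ?_) ?_
  · have h1 : ∀ y, ∑' x : ω.orbit, singTermL x₀ s Ψ y x =
        ∑' q : GL (Fin n) K ⧸ stabilizer (GL (Fin n) K) (SingL.base ω),
          orbitFunL x₀ s Ψ ω ((AdelicGroupData.gl n K).toAdelic (q.out⁻¹) * y) := fun y => by
      rw [SingL.tsum_orbit_eq ω (fun ξ => singTermL x₀ s Ψ y ξ)]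
      exact tsum_congr fun q => singTermL_smul_base x₀ s Ψ ω q.out y
    have h2 : ∀ y, ∑' x : ω.orbit, (‖singTermL x₀ s Ψ y x‖ₑ : ℝ≥0∞) =
        ∑' q : GL (Fin n) K ⧸ stabilizer (GL (Fin n) K) (SingL.base ω),
          ‖orbitFunL x₀ s Ψ ω ((AdelicGroupData.gl n K).toAdelic (q.out⁻¹) * y)‖ₑ := fun y => by
      rw [SingL.tsum_orbit_eq ω (fun ξ => (‖singTermL x₀ s Ψ y ξ‖ₑ : ℝ≥0∞))]
      exact tsum_congr fun q => by rw [singTermL_smul_base x₀ s Ψ ω q.out y]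
    simp_rw [h1]
    simp_rw [h2] at hfin
    exact integral_wt_mul_tsum_orbitFunL_eq_zero ν x₀ s hΨc hwm hw hψc hψinv hψcusp ω hfin
  · refine lt_of_le_of_lt (lintegral_mono fun y => le_of_eq ?_) hint
    rw [← tsum_eq_tsum_orbits_ennreal (G := GL (Fin n) K) fun ξ : SingL n K => (‖singTermL x₀ s Ψ y ξ‖ₑ : ℝ≥0∞)]

end Total

end Literature.NumberTheory.Automorphic
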